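import Summits.Ventures.Crystal3D.Theorems.StickyWulffConstantGenericWallFloorRiserEndRows
import Mathlib.Analysis.InnerProductSpace.Projection.Reflection
import HarnessLib

/-!
# The ONE-SIDED riser-end row `RiserEnd_E1_one` HOLDS — kernel proof, no census
# (crux `GenericWallFloor`, stmt-Ventures-19480, line `WallLedgerG`; cf-p2 R41v; complements wulff-p2 g11's
# `…RiserEndCoverRowsMin/Two`, which discharge the TWO-SIDED rows by sphere covering)

HONEST FRAMING. Venture `Summits/Ventures/Crystal3D` (cell `crystal3d-full`), helper `--supports` the crux
`GenericWallFloor` of `route-Ventures-StickyWulffConstant`, REGISTERED line `WallLedgerG`, open stub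
`stub_twoSlabAdhesion`; residual of record `GenericWallFloorCore`.  Rung credit only; F-C1 not moved; NOT the crux.
Pure proofs, standard axioms.

The one-sided rows `RiserEnd_E?_one` of `…GenericWallFloorRiserEndRows` have ISOLATED admissible points (the empty
hole sites themselves), so a sphere-covering certificate cannot close them; they need an exact local argument.  For
the Λ₂-side B-layer end `E1` (two ADJACENT in-plane holes) the exact argument is short:

* `riserEndE1one_model` — cubic model (`|u|² = 2`, slots `fccInt`, holes `(0,−1,1)`, `(−1,0,1)`): the ten other slots
  (`⟨u, v⟩ ≤ 1`) confine a further contact direction to `c = ±1…`: the belt inequalities `|a ± b| ≤ 1` give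
  `a² + b² ≤ 1`, hence `|c| ≥ 1`; `c ≤ −1` is excluded linearly; and ONE own-side ball — the common-A-layer ball at
  model position `(0,0,2)` (distance `√2` from the centre, diagonally below the two holes; integer frame `(−4,−4,2)`
  `∈ riserEnd_E1_ownSide`) — gives `⟨u,(0,0,2)⟩ ≤ 2`, i.e. `c ≤ 1`.  So `c = 1`, `a, b ≤ 0`, `a² + b² = 1`,
  `a + b ≥ −1` ⇒ `ab = 0` ⇒ `u` IS one of the two holes.  (This is the exact version of the float observation
  «one-sided, the only admissible extra positions are the hole sites», ROW-G2H-SPEC §2(b); the square-face pocket of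
  `twoHoles_adjacent_pocket` lies at `c > 1` and is capped by that single ball.)
* `contactsAtMostOff_of_model_obstacles` — wrapper: holes `h₁ ≠ h₂`, integer OBSTACLES `K` in the cubic model (none
  at slot distance), a model lemma «constraints ⇒ `u ∈ {h₁,h₂}`» ⇒ for every frame `A`, centre `b`:
  `ContactsAtMostOff b ((slots ∪ K).image (b + A·/√2)) (holes.image …) 10`;
* `mirror111_intVec`, `riserEnd_E1_one_frame_data` — the `(111)` mirror `(ℝ ∙ n)ᗮ.reflection` carries the cubic
  model onto the frame of `riserEnd_E1_*` (one `decide` for the three set identities);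
* **`riserEnd_E1_one_holds : RiserEnd_E1_one`** — with `E1`'s ten exact contacts and its own-side / common balls
  within radius `2` present (NO cross-gap information) and the two hole SITES empty, `E1` has at most ten contacts:
  it PAYS 2 one-sidedly.  With wulff-p2 g11's two-sided rows this leaves `E2_one`, `E3_one`, `E4_one` as the only
  riser-end obligations of `…RiserEndRows` not yet in the kernel.

WHAT THIS IS NOT: `E2_one` (four holes, claim ≤ 9) is not proved here; no wall law; F-C1 not moved.
-/

noncomputable section

namespace Summit.Ventures.Crystal3D.Theorems

open Finset Literature.Geometry.DiscreteGeometry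
open scoped RealInnerProductSpace

/-! ### Model: adjacent holes `(0,−1,1)`, `(−1,0,1)` + the common-layer ball at model `(0,0,2)` pin a contact to a hole -/

/-- E1 one-sided, cubic model (`|u|² = 2`): the ten exact slots other than the ADJACENT holes `(0,−1,1)`, `(−1,0,1)`
(`⟨u,v⟩ ≤ 1`) together with the own-side second-shell ball at model position `(0,0,2)` (the common-A-layer ball at
distance `√2`, constraint `⟨u,(0,0,2)⟩ ≤ 2`, i.e. `c ≤ 1`) force `u` to be one of the two holes: the square-face
pocket lies above `c = 1` and is killed by that ball. -/
theorem riserEndE1one_model (a b c : ℝ) (hn : a ^ 2 + b ^ 2 + c ^ 2 = 2)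
    (h : ∀ v ∈ fccInt, v ≠ ![0, -1, 1] → v ≠ ![-1, 0, 1] → a * v 0 + b * v 1 + c * v 2 ≤ 1)
    (k : 2 * c ≤ 2) : (a = 0 ∧ b = -1 ∧ c = 1) ∨ (a = -1 ∧ b = 0 ∧ c = 1) := by
  have h1 := h ![1, 1, 0] (by decide) (by decide) (by decide)
  have h2 := h ![1, -1, 0] (by decide) (by decide) (by decide)
  have h3 := h ![-1, 1, 0] (by decide) (by decide) (by decide)
  have h4 := h ![-1, -1, 0] (by decide) (by decide) (by decide)
  have h5 := h ![1, 0, 1] (by decide) (by decide) (by decide)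
  have h6 := h ![1, 0, -1] (by decide) (by decide) (by decide)
  have h7 := h ![-1, 0, -1] (by decide) (by decide) (by decide)
  have h8 := h ![0, 1, 1] (by decide) (by decide) (by decide)
  have h9 := h ![0, 1, -1] (by decide) (by decide) (by decide)
  have h10 := h ![0, -1, -1] (by decide) (by decide) (by decide)
  simp only [Matrix.cons_val_zero, Matrix.cons_val_one, Matrix.head_cons, Matrix.cons_val_two, Matrix.tail_cons,
    Int.cast_one, Int.cast_zero, Int.cast_neg, mul_one, mul_zero, mul_neg, add_zero, zero_add] at h1 h2 h3 h4 h5 h6 h7 h8 h9 h10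
  clear h
  have hp : (a + b) ^ 2 ≤ 1 := by
    have hq : 0 ≤ (1 - (a + b)) * (1 + (a + b)) := mul_nonneg (by linarith) (by linarith)
    have e : (a + b) ^ 2 = 1 - (1 - (a + b)) * (1 + (a + b)) := by ring
    rw [e]; linarith
  have hm : (a - b) ^ 2 ≤ 1 := by
    have hq : 0 ≤ (1 - (a - b)) * (1 + (a - b)) := mul_nonneg (by linarith) (by linarith)
    have e : (a - b) ^ 2 = 1 - (1 - (a - b)) * (1 + (a - b)) := by ring
    rw [e]; linarith
  have hab : a ^ 2 + b ^ 2 ≤ 1 := by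
    have e : a ^ 2 + b ^ 2 = ((a + b) ^ 2 + (a - b) ^ 2) / 2 := by ring
    rw [e]; linarith
  have hc2 : 1 ≤ c ^ 2 := by linarith
  rcases le_total 0 c with hc | hc
  · have hc1 : 1 ≤ c := by
      by_contra hlt
      push Not at hlt
      have := mul_self_lt_mul_self hc hlt
      nlinarith
    have hc' : c = 1 := by linarith
    subst hc'
    have ha : a ≤ 0 := by linarith
    have hb : b ≤ 0 := by linarith
    have hs : a ^ 2 + b ^ 2 = 1 := by linarith
    -- a,b ≤ 0, a + b ≥ -1, a² + b² = 1 ⇒ ab = 0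
    have hab0 : a * b = 0 := by
      have h0 : 0 ≤ a * b := by nlinarith
      nlinarith
    rcases mul_eq_zero.1 hab0 with ha0 | hb0
    · subst ha0
      have : b = -1 := by nlinarith
      exact Or.inl ⟨rfl, this, rfl⟩
    · subst hb0
      have : a = -1 := by nlinarith
      exact Or.inr ⟨this, rfl, rfl⟩
  · exfalso
    have hc1 : c ≤ -1 := by
      by_contra hlt
      push Not at hlt
      have hneg : 0 ≤ -c := by linarith
      have := mul_self_lt_mul_self hneg (show -c < 1 by linarith)
      nlinarith
    have hb0 : b = 0 := by linarith
    have ha0 : a = 0 := by linarith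
    subst hb0; subst ha0
    have : c = -1 := by linarith
    subst this
    norm_num at hn

/-! ### Wrapper: slots, extra own-side OBSTACLES and empty HOLE sites, in any frame -/

/-- **One-sided wrapper.**  Holes `h₁ ≠ h₂` (slots), integer OBSTACLES `K` in the cubic model (positions `b + A w/√2`,
none at slot distance: `|w|² ≠ 2`); if the model statement «`|u|² = 2`, `⟨u, v⟩ ≤ 1` for the other slots,
`⟨u, w⟩ ≤ |w|²/2` for the obstacles ⇒ `u ∈ {h₁, h₂}`» holds, then for every frame `A` and centre `b`: with the ten
slot balls and the obstacle balls present and the two hole SITES empty, `b` has at most ten contacts. -/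
theorem contactsAtMostOff_of_model_obstacles (h₁ h₂ : Fin 3 → ℤ) (hh₁ : h₁ ∈ fccInt) (hh₂ : h₂ ∈ fccInt)
    (hne : h₁ ≠ h₂) (K : Finset (Fin 3 → ℤ)) (hK : ∀ w ∈ K, sqNormInt w ≠ 2)
    (hmodel : ∀ a b c : ℝ, a ^ 2 + b ^ 2 + c ^ 2 = 2 →
      (∀ v ∈ fccInt, v ≠ h₁ → v ≠ h₂ → a * v 0 + b * v 1 + c * v 2 ≤ 1) →
      (∀ w ∈ K, a * w 0 + b * w 1 + c * w 2 ≤ (sqNormInt w : ℝ) / 2) →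
      (a = h₁ 0 ∧ b = h₁ 1 ∧ c = h₁ 2) ∨ (a = h₂ 0 ∧ b = h₂ 1 ∧ c = h₂ 2))
    (A : EuclideanSpace ℝ (Fin 3) ≃ₗᵢ[ℝ] EuclideanSpace ℝ (Fin 3)) (b : EuclideanSpace ℝ (Fin 3)) :
    ContactsAtMostOff b
      ((((fccInt.erase h₁).erase h₂) ∪ K).image fun v => b + (Real.sqrt 2)⁻¹ • A (intVec v))
      (({h₁, h₂} : Finset (Fin 3 → ℤ)).image fun v => b + (Real.sqrt 2)⁻¹ • A (intVec v)) 10 := by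
  classical
  intro X hX hF hH
  have hs0 : 0 < Real.sqrt 2 := by positivity
  have hs2 : Real.sqrt 2 ^ 2 = 2 := Real.sq_sqrt (by norm_num)
  have hsub : (X.filter fun q => dist b q = 1) ⊆
      ((fccInt.erase h₁).erase h₂).image fun v => b + (Real.sqrt 2)⁻¹ • A (intVec v) := by
    intro y hy
    rw [Finset.mem_filter] at hy
    obtain ⟨hyX, hyd⟩ := hy
    by_contra hyF
    exfalso
    set u : EuclideanSpace ℝ (Fin 3) := Real.sqrt 2 • A.symm (y - b) with hu
    clear_value u
    have hyb : ‖y - b‖ = 1 := by rw [← dist_eq_norm, dist_comm]; exact hyd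
    have hun : ‖u‖ ^ 2 = 2 := by
      rw [hu, norm_smul, Real.norm_of_nonneg hs0.le, LinearIsometryEquiv.norm_map, hyb, mul_one, hs2]
    have hcoord : u 0 ^ 2 + u 1 ^ 2 + u 2 ^ 2 = 2 := by
      have h := hun
      rw [EuclideanSpace.norm_eq, Real.sq_sqrt (Finset.sum_nonneg fun i _ => sq_nonneg _), Fin.sum_univ_three] at h
      simpa only [Real.norm_eq_abs, sq_abs] using h
    have hyu : y - b = A ((Real.sqrt 2)⁻¹ • u) := by
      rw [hu, smul_smul, inv_mul_cancel₀ hs0.ne', one_smul, LinearIsometryEquiv.apply_symm_apply]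
    have hyu' : (Real.sqrt 2)⁻¹ • A u = y - b := by rw [hyu, map_smul]
    have hinner : ∀ w : Fin 3 → ℤ, ⟪u, intVec w⟫ = u 0 * w 0 + u 1 * w 1 + u 2 * w 2 := fun w => by
      simp [intVec, PiLp.inner_apply, Fin.sum_univ_three, mul_comm]
    -- the generic non-overlap computation: a ball of `X` at `b + A w/√2`, `y ≠` it ⇒ `⟨u, w⟩ ≤ |w|²/2`
    have hgen : ∀ w : Fin 3 → ℤ, b + (Real.sqrt 2)⁻¹ • A (intVec w) ∈ X → y ≠ b + (Real.sqrt 2)⁻¹ • A (intVec w) →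
        u 0 * w 0 + u 1 * w 1 + u 2 * w 2 ≤ (sqNormInt w : ℝ) / 2 := by
      intro w hwX hneq
      have hd := hX y hyX _ hwX hneq
      have hvec : y - (b + (Real.sqrt 2)⁻¹ • A (intVec w)) = A ((Real.sqrt 2)⁻¹ • (u - intVec w)) := by
        simp only [map_smul, map_sub, smul_sub]
        rw [hyu']; abel
      have hdist : dist y (b + (Real.sqrt 2)⁻¹ • A (intVec w)) = (Real.sqrt 2)⁻¹ * ‖u - intVec w‖ := by
        rw [dist_eq_norm, hvec, LinearIsometryEquiv.norm_map, norm_smul, Real.norm_of_nonneg (inv_nonneg.2 hs0.le)]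
      rw [hdist] at hd
      have hnorm : Real.sqrt 2 ≤ ‖u - intVec w‖ := by
        have := mul_le_mul_of_nonneg_left hd hs0.le
        rwa [mul_one, ← mul_assoc, mul_inv_cancel₀ hs0.ne', one_mul] at this
      have hsq : 2 ≤ ‖u - intVec w‖ ^ 2 := by nlinarith [norm_nonneg (u - intVec w)]
      have hw : ‖intVec w‖ ^ 2 = (sqNormInt w : ℝ) := by
        rw [norm_intVec, Real.sq_sqrt (by exact_mod_cast (by unfold sqNormInt; positivity : (0 : ℤ) ≤ sqNormInt w))]
      rw [norm_sub_sq_real, hun, hw, hinner] at hsq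
      linarith
    have hineq : ∀ v ∈ fccInt, v ≠ h₁ → v ≠ h₂ → u 0 * v 0 + u 1 * v 1 + u 2 * v 2 ≤ 1 := by
      intro v hv hv1 hv2
      have hmem : v ∈ ((fccInt.erase h₁).erase h₂) := Finset.mem_erase.2 ⟨hv2, Finset.mem_erase.2 ⟨hv1, hv⟩⟩
      have hpF : b + (Real.sqrt 2)⁻¹ • A (intVec v) ∈
          ((fccInt.erase h₁).erase h₂).image fun v => b + (Real.sqrt 2)⁻¹ • A (intVec v) :=
        Finset.mem_image_of_mem _ hmem
      have hpX : b + (Real.sqrt 2)⁻¹ • A (intVec v) ∈ X :=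
        hF (Finset.mem_image_of_mem _ (Finset.mem_union_left _ hmem))
      have hneq : y ≠ b + (Real.sqrt 2)⁻¹ • A (intVec v) := fun e => hyF (e ▸ hpF)
      have hv2' : (sqNormInt v : ℝ) = 2 := by exact_mod_cast sqNormInt_fccInt v hv
      have := hgen v hpX hneq
      rw [hv2'] at this
      linarith
    have hobs : ∀ w ∈ K, u 0 * w 0 + u 1 * w 1 + u 2 * w 2 ≤ (sqNormInt w : ℝ) / 2 := by
      intro w hw
      have hwX : b + (Real.sqrt 2)⁻¹ • A (intVec w) ∈ X :=
        hF (Finset.mem_image_of_mem _ (Finset.mem_union_right _ hw))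
      -- `y` is not the obstacle: the obstacle is not at distance 1 from `b`
      have hneq : y ≠ b + (Real.sqrt 2)⁻¹ • A (intVec w) := by
        intro e
        have hwn : ‖intVec w‖ ^ 2 = (sqNormInt w : ℝ) := by
          rw [norm_intVec, Real.sq_sqrt (by exact_mod_cast (by unfold sqNormInt; positivity : (0 : ℤ) ≤ sqNormInt w))]
        have hd1 : dist b y = (Real.sqrt 2)⁻¹ * ‖intVec w‖ := by
          rw [e, dist_eq_norm, show b - (b + (Real.sqrt 2)⁻¹ • A (intVec w)) = -((Real.sqrt 2)⁻¹ • A (intVec w)) by abel,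
            norm_neg, norm_smul, Real.norm_of_nonneg (inv_nonneg.2 hs0.le), LinearIsometryEquiv.norm_map]
        rw [hyd] at hd1
        have h3 : ‖intVec w‖ = Real.sqrt 2 := by
          have := congrArg (fun t => Real.sqrt 2 * t) hd1
          simp only [mul_one, ← mul_assoc, mul_inv_cancel₀ hs0.ne', one_mul] at this
          exact this.symm
        have : (sqNormInt w : ℝ) = 2 := by rw [← hwn, h3, hs2]
        exact hK w hw (by exact_mod_cast this)
      exact hgen w hwX hneq
    have key : ∀ w : Fin 3 → ℤ, w ∈ ({h₁, h₂} : Finset (Fin 3 → ℤ)) →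
        u 0 = w 0 ∧ u 1 = w 1 ∧ u 2 = w 2 → False := by
      rintro w hw ⟨e0, e1, e2⟩
      have hueq : u = intVec w := by
        ext i; fin_cases i
        · simpa using e0
        · simpa using e1
        · simpa using e2
      have hy' : y = b + (Real.sqrt 2)⁻¹ • A (intVec w) := by
        rw [← hueq, hyu']; abel
      exact hH _ (Finset.mem_image_of_mem _ hw) (hy' ▸ hyX)
    rcases hmodel (u 0) (u 1) (u 2) hcoord hineq hobs with hc | hc
    · exact key h₁ (by simp) hc
    · exact key h₂ (by simp) hc
  calc (X.filter fun q => dist b q = 1).card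
      ≤ (((fccInt.erase h₁).erase h₂).image fun v => b + (Real.sqrt 2)⁻¹ • A (intVec v)).card :=
        Finset.card_le_card hsub
    _ ≤ ((fccInt.erase h₁).erase h₂).card := Finset.card_image_le
    _ = 10 := by
        rw [Finset.card_erase_of_mem (Finset.mem_erase.2 ⟨hne.symm, hh₂⟩), Finset.card_erase_of_mem hh₁, card_fccInt]

/-! ### The `(111)` mirror frame and the discharge of `RiserEnd_E1_one` -/

/-- The `(111)` mirror `x ↦ x − (2/3)(Σx)(1,1,1)` on integer vectors, rescaled to the frame of `…RiserEndRows`: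
`R(v)/√2 = hcpPt (3v − 2(Σv)(1,1,1))` for the unit normal `n = (1,1,1)/√3`. -/
theorem mirror111_intVec (v : Fin 3 → ℤ) :
    (Real.sqrt 2)⁻¹ • (ℝ ∙ ((Real.sqrt 3)⁻¹ • intVec ![1, 1, 1]))ᗮ.reflection (intVec v) =
      hcpPt ![3 * v 0 - 2 * (v 0 + v 1 + v 2), 3 * v 1 - 2 * (v 0 + v 1 + v 2), 3 * v 2 - 2 * (v 0 + v 1 + v 2)] := by
  have h3 : (sqNormInt ![1, 1, 1] : ℝ) = 3 := by
    norm_num [sqNormInt, Matrix.cons_val_zero, Matrix.cons_val_one, Matrix.head_cons, Matrix.cons_val_two, Matrix.tail_cons]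
  have hs3p : 0 < Real.sqrt 3 := by positivity
  have hn : ‖(Real.sqrt 3)⁻¹ • intVec ![1, 1, 1]‖ = 1 := by
    rw [norm_smul, norm_inv, Real.norm_of_nonneg hs3p.le, norm_intVec, h3, inv_mul_cancel₀ hs3p.ne']
  rw [Submodule.reflection_orthogonal_apply, Submodule.reflection_singleton_apply, hn]
  simp only [RCLike.ofReal_real_eq_id, id_eq, one_pow, div_one]
  rw [real_inner_smul_left]
  have hinner : ⟪intVec ![1, 1, 1], intVec v⟫ = (v 0 + v 1 + v 2 : ℝ) := by
    simp [intVec, PiLp.inner_apply, Fin.sum_univ_three]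
  rw [hinner]
  have h18 : Real.sqrt 18 = 3 * Real.sqrt 2 := by
    rw [show (18 : ℝ) = 3 ^ 2 * 2 by norm_num, Real.sqrt_mul (by norm_num), Real.sqrt_sq (by norm_num)]
  have hs2 : Real.sqrt 2 ≠ 0 := by positivity
  have hs3 : Real.sqrt 3 ≠ 0 := hs3p.ne'
  unfold hcpPt
  rw [h18]
  ext i
  fin_cases i <;>
    · simp [intVec, smul_smul, two_smul]
      field_simp
      rw [show Real.sqrt 3 ^ 2 = 3 from Real.sq_sqrt (by norm_num)]
      ring

/-- Data check for the frame identification (one `decide`): the integer mirror map carries the ten model slots onto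
`riserEnd_E1_own`, the model obstacle `(0,0,2)` to the own-side ball `(−4,−4,2) ∈ riserEnd_E1_ownSide` (the common
A-layer ball below the holes), and the holes to `riserEnd_E1_holes`. -/
theorem riserEnd_E1_one_frame_data :
    ((fccInt.erase ![0, -1, 1]).erase ![-1, 0, 1]).image
        (fun v : Fin 3 → ℤ => ![3 * v 0 - 2 * (v 0 + v 1 + v 2), 3 * v 1 - 2 * (v 0 + v 1 + v 2),
          3 * v 2 - 2 * (v 0 + v 1 + v 2)]) = riserEnd_E1_own ∧
    (![-4, -4, 2] : Fin 3 → ℤ) ∈ riserEnd_E1_ownSide ∧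
    (({![0, -1, 1], ![-1, 0, 1]} : Finset (Fin 3 → ℤ)).image
        (fun v : Fin 3 → ℤ => ![3 * v 0 - 2 * (v 0 + v 1 + v 2), 3 * v 1 - 2 * (v 0 + v 1 + v 2),
          3 * v 2 - 2 * (v 0 + v 1 + v 2)])) = riserEnd_E1_holes := by
  refine ⟨by decide, by decide, by decide⟩

/-- **The one-sided riser-end row `RiserEnd_E1_one` HOLDS (kernel, census-free).**  The Λ₂-side B-layer end ball of
the T = 0 twin riser, with its ten exact contacts and its own-side / common-layer balls within radius 2 present (NO
cross-gap information) and its two hole SITES empty, has at most ten contacts: it PAYS 2.  Only ONE own-side ball is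
used — the common-A-layer ball at distance `√2` diagonally below the two holes, which caps the square-face pocket. -/
theorem riserEnd_E1_one_holds : RiserEnd_E1_one := by
  classical
  have hw := contactsAtMostOff_of_model_obstacles ![0, -1, 1] ![-1, 0, 1] (by decide) (by decide) (by decide)
    {![0, 0, 2]} (by decide)
    (fun a b c hn h hk => by
      have hk2 := hk ![0, 0, 2] (by simp)
      norm_num [sqNormInt, Matrix.cons_val_zero, Matrix.cons_val_one, Matrix.head_cons, Matrix.cons_val_two,
        Matrix.tail_cons] at hk2
      rcases riserEndE1one_model a b c hn h (by linarith) with ⟨rfl, rfl, rfl⟩ | ⟨rfl, rfl, rfl⟩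
      · left; simp
      · right; simp)
    ((ℝ ∙ ((Real.sqrt 3)⁻¹ • intVec ![1, 1, 1]))ᗮ.reflection) 0
  -- F_w ⊆ F_target and H_w ⊆ H_target
  intro X hX hF hH
  refine hw X hX ?_ ?_
  · intro x hx
    obtain ⟨v, hv, rfl⟩ := Finset.mem_image.1 hx
    apply hF
    rw [zero_add, mirror111_intVec]
    refine Finset.mem_image_of_mem _ ?_
    rcases Finset.mem_union.1 hv with hv | hv
    · refine Finset.mem_union_left _ ?_
      rw [← riserEnd_E1_one_frame_data.1]; exact Finset.mem_image_of_mem _ hv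
    · refine Finset.mem_union_right _ ?_
      rw [Finset.mem_singleton] at hv; subst hv
      exact riserEnd_E1_one_frame_data.2.1
  · intro s hs
    obtain ⟨v, hv, rfl⟩ := Finset.mem_image.1 hs
    apply hH
    rw [zero_add, mirror111_intVec, ← riserEnd_E1_one_frame_data.2.2]
    exact Finset.mem_image_of_mem _ (Finset.mem_image_of_mem _ hv)

end Summit.Ventures.Crystal3D.Theorems

end
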